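import Literature.FieldTheory.Separability.FormallySmoothAlgebraic
import HarnessLib

/-!
# Formally smooth field extensions are relatively `p`-radically closed

Route `ResolutionOfSingularities/WeightedInvariant`, door crux `HypersurfaceCentreConstruction`
(stmt-ResolutionOfSingularities-19897) — OURS, helper; e-ladder `e = 1`: the rung
`ELadderOne.admissiblyResolvableDim_one_of_AQS` (p520391) is conditional on the vendored fact
`AbramovichQuekSchober2025_separableBaseChange` («`J` is stable under base change to separable field extensions of
`k`»); piece **(o25-δ)** «separable base change in the kernel» (res-D-pv-025 AS stub-10, OFFER 2026-08-27T09:58Z).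
This file is its FIELD-THEORY BRICK: the exact point where separability of `k′/k` is used in the proof — a
steepening `y ↦ y - λ x^b` defined over the bigger residue field `κ′ = κ(η′)` with `λ̄^{p^m} ∈ κ` must already be
defined over `κ`.

* `mem_range_algebraMap_of_pow_mem` — if `L/E` is a formally smooth extension of fields of exponential
  characteristic `p` and `y ∈ L` has `y ^ p ∈ E`, then `y ∈ E`;
* `mem_range_algebraMap_of_pow_pow_mem` — the same for `y ^ (p ^ n) ∈ E`.

Proof: if `y ^ p = a ∈ E` with `a ∉ E^p`, the `p`-basis theorem in its weakest form
(`exists_derivation_apply_eq_one_of_forall_pow_ne`, Zorn on partial derivations) gives a derivation `D` of `E`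
with `D a = 1`, while formal smoothness of `L/E` extends every derivation `E → L` to `L`, where `a = y^p` has
zero derivative (`Derivation.apply_eq_zero_of_formallySmooth`).  Both inputs are the tree's
(`Literature/FieldTheory/Separability/FormallySmoothAlgebraic.lean`); this is the relative form of Matsumura's
Thm. 26.9, "`0`-smooth ⇒ separable" [cite: Matsumura1987, Thm. 26.9; §26 (`p`-bases)].

Def-free; no named facts; nothing here is a claim about Hironaka's problem.  AI-written; weaker than expert review.
-/

noncomputable section

set_option linter.dupNamespace false -- mandated namespace of this single-conjunct summit

namespace Summit.ResolutionOfSingularities.ResolutionOfSingularities.Theorems.AQSBaseChange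

open Literature.FieldTheory.Separability

universe u v

variable {E : Type u} {L : Type v} [Field E] [Field L] [Algebra E L]

/-- A derivation of `E` into itself, pushed forward to values in the extension `L`. [folklore] -/
theorem exists_derivation_algebraMap (D : Derivation ℤ E E) :
    ∃ D' : Derivation ℤ E L, ∀ a, D' a = algebraMap E L (D a) := by
  refine ⟨{ toLinearMap := ((algebraMap E L : E →+ L).comp (D.toLinearMap.toAddMonoidHom)).toIntLinearMap
            map_one_eq_zero' := by simp
            leibniz' := fun b c => by
              change algebraMap E L (D (b * c)) = b • algebraMap E L (D c) + c • algebraMap E L (D b)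
              simp only [Derivation.leibniz, smul_eq_mul, map_add, map_mul, Algebra.smul_def] }, fun a => rfl⟩

/-- **A formally smooth field extension is relatively `p`-radically closed**: if `L/E` is formally smooth, `p`
is the exponential characteristic, and `y ∈ L` satisfies `y ^ p ∈ E`, then `y ∈ E`.
[cite: Matsumura1987, Thm. 26.9] -/
theorem mem_range_algebraMap_of_pow_mem [Algebra.FormallySmooth E L] (p : ℕ) [ExpChar E p] {y : L}
    (hy : y ^ p ∈ (algebraMap E L).range) : y ∈ (algebraMap E L).range := by
  obtain ⟨a, ha⟩ := hy
  rcases ‹ExpChar E p› with _ | ⟨hprime⟩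
  · exact ⟨a, by simpa using ha⟩
  · haveI : Fact p.Prime := ⟨hprime⟩
    haveI : CharP L p := charP_of_injective_algebraMap (algebraMap E L).injective p
    haveI : ExpChar L p := ExpChar.prime hprime
    by_cases hap : ∃ b : E, b ^ p = a
    · obtain ⟨b, hb⟩ := hap
      refine ⟨b, ?_⟩
      have h : (algebraMap E L b) ^ p = y ^ p := by rw [← map_pow, hb, ha]
      exact frobenius_inj L p h
    · push Not at hap
      obtain ⟨D, hD⟩ := exists_derivation_apply_eq_one_of_forall_pow_ne p a hap
      obtain ⟨D', hD'⟩ := exists_derivation_algebraMap (L := L) D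
      have h0 := Derivation.apply_eq_zero_of_formallySmooth p D' ha.symm
      rw [hD', hD, map_one] at h0
      exact absurd h0 one_ne_zero

/-- The same for `p ^ n`-th powers: if `y ^ (p ^ n) ∈ E` then `y ∈ E`. [cite: Matsumura1987, Thm. 26.9] -/
theorem mem_range_algebraMap_of_pow_pow_mem [Algebra.FormallySmooth E L] (p : ℕ) [ExpChar E p] (n : ℕ)
    {y : L} (hy : y ^ (p ^ n) ∈ (algebraMap E L).range) : y ∈ (algebraMap E L).range := by
  induction n generalizing y with
  | zero => simpa using hy
  | succ n ih =>
    apply ih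
    apply mem_range_algebraMap_of_pow_mem p
    rwa [← pow_mul, ← pow_succ]

end Summit.ResolutionOfSingularities.ResolutionOfSingularities.Theorems.AQSBaseChange

end
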